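/- Copyright: the b2b-balaban cell (near-miss cell 7), T⁴-continuum fan-out; row NE7b CRUX team (2), seat
t4-ne7b-formalise-leaf-04 (gen 34) — the row OWNER t4-ne7b-p1's RULING R-OWNER-48-1 «THE GUARDED CUT» (gen 48,
`CLAIMS.log` l.32451), INTERFACE REQUEST NE7b IR-48-1, file L3b: the re-homed VS-headline (IR-47-2 module B, p281090)
over the GUARDED witness `CountRoadWitnessT3bWTVSL` (owner's L3a) and the guarded pinned END v3.1 (leaf-02's L2).
Released under the licence of the surrounding project. -/
import Summits.QuantumFields.BalabanUV.T4Continuum.Support.HistoryRealiseCellsRunApexT3bWTVSL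
import Summits.QuantumFields.BalabanUV.T4Continuum.Support.HistoryRealiseCellsRunPinnedT3bPWTL

/-!
# Realised histories: ROW NE7b AT THE APEX AND THE HEADLINE OVER THE REPAIRED END v3.1 FROM THE GUARDED WEIGHTED
`κ := costT` WITNESS, SPLIT SLACK — file L3b of the guarded cut (R-b)

Summits-side support leaf of the T⁴-continuum cell (rung (B)+1 on a FINITE torus only; NOT infinite volume, NOT the
mass gap, NOT the Clay statement; NOT a proof of the spine estimate NE7b, which is the cell's OWN estimate, NOT PRINTED
and NOT PROVED).  [folklore] composition by name: leaf-02's guarded pinned END v3.1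
`HistoryRealiseCellsRunPinnedT3bPWTL.hybridNE7_of_realisedDomainsRunW_pinnedT3bPDTL` (L2: E5T with the ONE binder `hDJ`
retyped to the guarded display `DisjointJoinsL`) AT THE RE-SLACKED RECORD `reslack O θᵥ`, fed — by E8T's destructuring
proof (`HistoryRealiseCellsRunHeadlineT3bPWT` :106–127) — with the fields of the owner's guarded witness
`HistoryRealiseCellsRunApexT3bWTVSL.CountRoadWitnessT3bWTVSL` (L3a: leaf-02's `CountRoadWitnessT3bWTVS` p265435 with the
ONE field `disjointJoins` retyped), the two field-local conversions of the landed embeddings INLINE (`κ := costT`,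
`cost_le := le_rfl` — the owner's `toWT` p263890; the price sentences re-slacked by `pshapeTH_mul_exp_birthWT_le_reslack`
with `huV` — leaf-02's `toWTV` p265435), the string step by L3a's bridge
`stringHybridNE7_of_hybridNE7T3bWTVSL` (= the structure-free `HistoryRealiseCellsRunApexT3b.stringHybridNE7_of_hybridNE7_repr`); no definition, no `[cite:]` tag, nothing printed
asserted, no `Prop` fact minted, zero `sorry`.  Append-only: B `HistoryRealiseCellsRunHeadlineT3bPWTVS` (p281090), A
(p279782), E8T, the V∕VS modules and the headline of record p224237 stay, UNCHANGED BY NAME.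

WHY (R-OWNER-47-3 ∕ R-OWNER-48-1; leaf-02-g29's located finding F-ne7bleaf02g29-1).  The witness field `disjointJoins :
… DisjointJoins ((ped K τ).toPGen (cellP K τ) c)` carried by every landed count-road witness (W ∕ WT ∕ WTV ∕ WTVS) is
MISSTATED AS TYPED: the unguarded display compares birth regions across labels and is unsatisfiable on non-trivial
genealogies (`HistoryRealiseDistinctGuarded.Sanity.not_disjointJoins_nestedToy`), so B's prefixed hypothesis — a
`CountRoadWitnessT3bWTVS` for all small-coupling tuned runs — is not an honest hypothesis for the (α) assembly to
inhabit.  The END consumes the field only through `nodup_map_pbirths`, whose guarded twin `nodup_map_pbirths_L` takes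
`DisjointJoinsL` (labels equal ⇒ regions disjoint), and `DisjointJoinsL` IS a theorem on pass V
(`HistoryGenealogyJunctionVDistinct.InputFamily.disjointJoinsL_pedV`, leaf-02's IR-47-1′).  The gate has no
reviewed-mutation lane (`theorems.append-only`), hence the guarded TWIN CHAIN on the P-road: L1
`HistoryAssemblyMultInstanceWL` → L2 `…PinnedT3bPWTL` (leaf-02), L3a `…ApexT3bWTVSL` (owner), THIS FILE L3b, then the
custodian's L4∕L5 (`HistReadDataL`, `…AssemblyWTVSL` with `continuumYM4Torus_of_histReadingL_fsc` over this file's headline).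

WHAT.  §1 **`hybridNE7Under_of_countRoadT3bPWTVSL_fsc`** (apex input), `limit_exists_of_countRoadT3bPWTVSL_fsc`,
`limit_unique_of_countRoadT3bPWTVSL_fsc`; §2 `targets_of_countRoadT3bPWTVSL_fsc`, **`continuumYM4Torus_of_countRoadT3bPWTVSL_fsc`**:
binders VERBATIM = B's (p281090) except `CountRoadWitnessT3bWTVS ↦ CountRoadWitnessT3bWTVSL` (`hθ : 0 < θ`, split slack
`C.a + (θ + θᵥ) ≤ ½γ₀A₁²`, NO `hθJ`; constants side served BY NAME by B's `exists_consts_countRoadT3bPWTVS`, no twin);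
conclusions BYTE-IDENTICAL.  §3 one closing `example`: B's headline statement (binder TYPES verbatim) ⇒ its
conclusion THROUGH THIS FILE, each landed VS-witness being an L-witness by the owner's `CountRoadWitnessT3bWTVS.toL`
(`disjointJoinsL_of_disjointJoins`) — L ⊒ B BY NAME.  No V- or WT-level L-structures (none needed: the END is fed
field by field).

BY-NAME EFFECT ON THE WALL (`WALL-NE7b-P1.md` §2 v1.22, the owner's record): row `disjointJoins` — MISSTATED-AS-TYPED,
deprecated in place, guarded twin K on pass V; row `boxedBirths` — K modulo `RegionsInBox`; every other binder's class
UNCHANGED; the (α) programme's headline of record moves to `continuumYM4Torus_of_countRoadT3bPWTVSL_fsc` once L5 reads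
it.  DISPLAYED, NOT DISCHARGED: H3^NE7b's `realised` reading and numerator ∕ price readings, (B), `BetaPertHyp`, the
flow box bounds ∕ tuning ∕ IR smallness, NE7c's `ShellWeightBound`, NE7's `ReindexedBudget` + four summable rates.
HONEST: NE7b NOT proved; spine 0∕9; rung (B)+1 finite T⁴ — NOT infinite volume, NOT mass gap, NOT Clay.  HONEST
DEPENDENCY (cell): continuum YM on T⁴ ⇐ BetaPertH ∧ nine spine estimates (0/9 proved); BetaPertH ⇐ (D1) ∧ (D4) ∧
CAP+tail; G-an2-4 gates asym, D1 and NE2/3/4.  This file changes none of it.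

v1.1 (seat t4-ne7b-formalise-leaf-04, gen 37; DOCSTRING ONLY — every declaration, binder, proof, `import` and `open` line of
v1 = p285957 is byte-identical).  (i) DOCFIX INFO-59-1 (referee `t4/formal/NE7b/REFEREE.md` passes 59–60: the cell's chain,
wrapped across lines above, is owed VERBATIM on one line) — HONEST DEPENDENCY: continuum YM on T⁴ ⇐ BetaPertH ∧ nine spine estimates (0/9 proved); BetaPertH ⇐ (D1) ∧ (D4) ∧ CAP+tail; G-an2-4 gates asym, D1 and NE2/3/4.
(ii) FORWARD POINTER (OI-77 ∕ SPEC D-48-1): `continuumYM4Torus_of_countRoadT3bPWTVSL_fsc` below is the headline READ by the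
custodian's L5 `HistoryRealiseCellsRunAssemblyWTVSL.continuumYM4Torus_of_histReadingL_fsc` (its `hData` supplied from the
record `HistReadDataL` by `nonempty_countRoadWitnessT3bWTVSL_of_histReadingL`) and, through `HistReadDataLW.toL` at the two
coupling windows, by the (α) terminal theorem of record `HistoryRealiseCellsRunAssemblyWTVSLW.continuumYM4Torus_of_histReadingLW_fsc`
(IR-48-3); the unguarded module B `HistoryRealiseCellsRunHeadlineT3bPWTVS` and module A `HistoryRealiseCellsRunApexT3bPWTV`
carry the SUPERSEDED-IN-PLACE marking pointing here.  Nothing in THIS file is superseded; NE7b NOT proved; spine 0∕9. -/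

open Finset MeasureTheory
open Literature.MathematicalPhysics.QuantumFieldTheory.Balaban1983to89
open T4PersistenceDictionary T4PersistentHistoryCount T4BankedInduction T4PrintedShapeBanking
open T4WeightBudget T4GlobalDenominator T4LiveClassFibration T4LiveStructureGas T4LiveGasToTerms T4RecordPriceSeam
open T4PartnerMultiplicity T4IndicatorShell T4MatchingAssembly T4MatchingClosure T4MatchingClosureSocket T4Continuum
open T4StabilitySocket T4BranchingRecordsGas T4TaggedShapeBanking T4CanonicalMenus T4RenewalChains
open Summit.QuantumFields.BalabanUV.T4Continuum.PlacementBatch Summit.QuantumFields.BalabanUV.T4Continuum.PlacementSkeleton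
open Summit.QuantumFields.BalabanUV.T4Continuum.CountThresholdUniform Summit.QuantumFields.BalabanUV.T4Continuum.CountThresholdExit
open Summit.QuantumFields.BalabanUV.T4Continuum.CountSeamJunction Summit.QuantumFields.BalabanUV.T4Continuum.LateMergers
open Summit.QuantumFields.BalabanUV.T4Continuum.HistoryFlow Summit.QuantumFields.BalabanUV.T4Continuum.HistoryRegeneration
open Summit.QuantumFields.BalabanUV.T4Continuum.HistoryTables Summit.QuantumFields.BalabanUV.T4Continuum.HistoryAssemblyTrees
open Summit.QuantumFields.BalabanUV.T4Continuum.HistoryAssemblyTerms Summit.QuantumFields.BalabanUV.T4Continuum.HistoryAssemblyPedigree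
open Summit.QuantumFields.BalabanUV.T4Continuum.HistoryConstants Summit.QuantumFields.BalabanUV.T4Continuum.HistoryGen
open Literature.MathematicalPhysics.QuantumFieldTheory.Balaban1983to89.B13ScaleTransfer
open Summit.QuantumFields.BalabanUV.T4Continuum.ZoneSkeleton Summit.QuantumFields.BalabanUV.T4Continuum.HistorySocketTH
open Summit.QuantumFields.BalabanUV.T4Continuum.HistoryCaps Summit.QuantumFields.BalabanUV.T4Continuum.HistoryAssemblyPrice
open Summit.QuantumFields.BalabanUV.T4Continuum.HistoryBankingLE Summit.QuantumFields.BalabanUV.T4Continuum.HistoryExitLE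
open Summit.QuantumFields.BalabanUV.T4Continuum.HistoryAssemblyTreesLE Summit.QuantumFields.BalabanUV.T4Continuum.HistoryAssemblyTermsLE
open Summit.QuantumFields.BalabanUV.T4Continuum.HistoryRealise Summit.QuantumFields.BalabanUV.T4Continuum.HistoryAssemblyRealiseLE
open Summit.QuantumFields.BalabanUV.T4Continuum.HistoryAssemblyMult Summit.QuantumFields.BalabanUV.T4Continuum.HistoryAssemblyMultKey
open Summit.QuantumFields.BalabanUV.T4Continuum.HistoryAssemblyRealiseRun Summit.QuantumFields.BalabanUV.T4Continuum.HistoryAssemblyRealiseMult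
open Summit.QuantumFields.BalabanUV.T4Continuum.HistoryZones Summit.QuantumFields.BalabanUV.T4Continuum.HistoryRealiseCells
open Summit.QuantumFields.BalabanUV.T4Continuum.HistoryRealiseCellsRun Summit.QuantumFields.BalabanUV.T4Continuum.HistoryAssemblyRealiseRunMult
open Summit.QuantumFields.BalabanUV.T4Continuum.HistoryRealiseCellsRunMult Summit.QuantumFields.BalabanUV.T4Continuum.HistoryAssemblyMultInstance
open Summit.QuantumFields.BalabanUV.T4Continuum.HistoryJoinsPlacedMember Summit.QuantumFields.BalabanUV.T4Continuum.PlacementSkeleton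
open Summit.QuantumFields.BalabanUV.T4Continuum.HistoryJoinsPlacedMult Summit.QuantumFields.BalabanUV.T4Continuum.HistoryRealiseDistinct
open Summit.QuantumFields.BalabanUV.T4Continuum.HistoryRegionTemplates Summit.QuantumFields.BalabanUV.T4Continuum.HistoryCaps
open Summit.QuantumFields.BalabanUV.T4Continuum.HistoryZoneEvolve (cth)
open Literature.MathematicalPhysics.QuantumFieldTheory.Balaban1983to89.B16SProfile (DropCtl)
open Summit.QuantumFields.BalabanUV.T4Continuum.HistoryRealiseCellsRunMultEnd Summit.QuantumFields.BalabanUV.T4Continuum.HistoryRealiseCellsRunMultEndD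
open Summit.QuantumFields.BalabanUV.T4Continuum.HistoryRealiseCellsRunPinnedT3b Summit.QuantumFields.BalabanUV.T4Continuum.HistoryHybridRescale
open Summit.QuantumFields.BalabanUV.T4Continuum.HistoryRealiseCellsRunApex (exists_const_schemeZ)
open Summit.QuantumFields.BalabanUV.T4Continuum.HistoryRealisePrint Summit.QuantumFields.BalabanUV.T4Continuum.HistoryRealiseWeak
open Summit.QuantumFields.BalabanUV.T4Continuum.HistoryRealisePrintReading Summit.QuantumFields.BalabanUV.T4Continuum.HistoryRealiseWeakReading
open Summit.QuantumFields.BalabanUV.T4Continuum.HistoryRealisePrintCells Summit.QuantumFields.BalabanUV.T4Continuum.HistoryRealiseWeakCells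
open Summit.QuantumFields.BalabanUV.T4Continuum.HistoryRealiseCellsRunApexT3b Summit.QuantumFields.BalabanUV.T4Continuum.HistoryRealiseCellsRunApexT3bW

open Summit.QuantumFields.BalabanUV.T4Continuum.HistoryRealiseCellsRunApexT3bWT Summit.QuantumFields.BalabanUV.T4Continuum.HistoryRealiseCellsRunPinnedT3bWT
open Summit.QuantumFields.BalabanUV.T4Continuum.HistoryRealiseCellsRunHeadlineT3bWT
open Summit.QuantumFields.BalabanUV.T4Continuum.HistoryRealiseCellsRunApexT3bWTV Summit.QuantumFields.BalabanUV.T4Continuum.HistoryBankingVolumePlug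
open Summit.QuantumFields.BalabanUV.T4Continuum.HistoryRealiseCellsRunApexT3bWTVS
open Summit.QuantumFields.BalabanUV.T4Continuum.HistoryRealiseCellsRunApexT3bWTVSL
open Summit.QuantumFields.BalabanUV.T4Continuum.HistoryRealiseCellsRunPinnedT3bPWTL

namespace Summit.QuantumFields.BalabanUV.T4Continuum.HistoryRealiseCellsRunHeadlineT3bPWTVSL

noncomputable section

section Under

variable {F : T4Family} {G : Type*} [GaugeGroup G] [MeasurableSpace G] [HaarData G] [RegularGaugeGroup G]

/-! ## §1 The apex input over the guarded repaired END v3.1 from the guarded weighted witness -/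

/-- **ROW NE7b AT THE APEX OVER THE GUARDED REPAIRED END v3.1 FROM THE GUARDED WEIGHTED `κ := costT` WITNESS, SPLIT
SLACK, NO DEMAND ON PRINT's CONSTANTS**: leaf-02's L2 `hybridNE7_of_realisedDomainsRunW_pinnedT3bPDTL` at `reslack O θᵥ`
(`reslack_hslack`), its sixty-odd witness inputs fed from a `CountRoadWitnessT3bWTVSL` field by field with the two
conversions inline (`κ := costT`, `cost_le := le_rfl`; price sentences re-slacked by
`pshapeTH_mul_exp_birthWT_le_reslack` with `huV`), thresholds `min γ₁ γ₂` ∕ `min g₁ g₂` as in E8T, the string step by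
L3a's `stringHybridNE7_of_hybridNE7T3bWTVSL`; binders = B's with `CountRoadWitnessT3bWTVS ↦ CountRoadWitnessT3bWTVSL`; conclusion
identical.  CONDITIONAL; NE7b NOT proved. [folklore] -/
theorem hybridNE7Under_of_countRoadT3bPWTVSL_fsc (D : FiniteEpsData F G) (hM : D.AvgMeasurable)
    (hsign : B16.SignConventions D.C)
    {C : T4PrintedShapeBanking.Consts} {O : PrintedO1s}
    {rr : ℕ} {β₀ : ℝ} (h : ThresholdOK C F.L rr β₀) (hμ : 0 < C.μ) (d n : ℕ)
    (hκ₁ : (d : ℝ) * Real.log F.L + 2 * Real.log 2 ≤ C.κ₁) (hE₀ : Real.log (2 + birthMass C) ≤ C.E₀)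
    (hA₀ : 1 ≤ C.A₀) (hβ₀ : 0 < β₀) (hLβ : (F.L : ℝ) * β₀ ≤ 1) (hn₁ : 13 ≤ C.n₁) (hn : 0 < n)
    {θ θv : ℝ} (hθ : 0 < θ) (hslack : C.a + (θ + θv) ≤ O.γ₀ * O.A₁ ^ 2 / 2)
    (hE₂ : 0 < C.E₂) (hE₃ : 0 ≤ C.E₃) {sS : ℕ} (hsS : 1 ≤ sS)
    (hsmall : (((2 * cth 32 1 sS + 1) ^ d : ℕ) : ℝ) * (5 : ℝ) ^ d * ((max 1 (2 * 32 + 2) : ℕ) : ℝ) ≤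
      (F.L : ℝ) ^ (sS / 2) / 2)
    {θc : ℝ} (hθc0 : 0 ≤ θc) (hθc1 : θc < 1) (hθcs : 1 / 2 ≤ θc ^ sS)
    (hData : T4ContinuumYM4Torus.ForSmallCouplings D fun g₀ => ∀ os : List (ULoop F),
        ∃ (ι α π : Type) (_ : DecidableEq ι) (_ : DecidableEq α) (_ : DecidableEq π),
          Nonempty (CountRoadWitnessT3bWTVSL D C O θv rr d n hn g₀ os ι α π)) :
    T4ApexHybrid.HybridNE7Under D (BetaPertHyp D.βfun) := by
  intro hB hβ
  obtain ⟨γ₁, hγ₁, H⟩ := hybridNE7_of_realisedDomainsRunW_pinnedT3bPDTL D hB hβ hsign h hμ d n hκ₁ hE₀ hA₀ hβ₀ hLβ hn₁ hn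
    hθ (reslack_hslack hslack) hE₂ hE₃ hsS hsmall hθc0 hθc1 hθcs
  obtain ⟨γ₂, hγ₂, H₂⟩ := hData
  refine ⟨min γ₁ γ₂, lt_min hγ₁ hγ₂, fun γ hγ hγle => ?_⟩
  obtain ⟨g₁, hg₁, Hg⟩ := H γ hγ (hγle.trans (min_le_left _ _))
  obtain ⟨g₂, hg₂, Hg₂⟩ := H₂ γ hγ (hγle.trans (min_le_right _ _))
  refine ⟨min g₁ g₂, lt_min hg₁ hg₂, fun g hg hgle g₀ ht os => ?_⟩
  obtain ⟨Em, -, HE⟩ := Hg g hg (hgle.trans (min_le_left _ _))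
  obtain ⟨ι, α, π, _, _, _, ⟨X⟩⟩ := Hg₂ g hg (hgle.trans (min_le_right _ _)) g₀ ht os
  have hm : ∀ K o, Measurable ((D.scheme g₀).obs K o) := fun K o => D.measurable_avgObs hM K o
  have h1 : ∀ K o U, |(D.scheme g₀).obs K o U| ≤ 1 := fun K o U => D.abs_avgObs_le_one K o U
  obtain ⟨K₁, K₂, hK₁, hH⟩ := HE g₀ ht X.l₀ X.vol X.K₀ X.T X.A X.A' X.shA X.shB X.dead X.dead' X.nup X.mup X.Nup
    X.Cc X.Rr X.CcRec X.RrRec X.ν X.u X.s₂ X.q₀ X.r X.s X.Wsh (fun K => T4GenFunBounds.prodObs (D.scheme g₀) K os) 1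
    (fun K => T4GenFunBounds.measurable_prodObs (D.scheme g₀) hm K os)
    (fun K U => T4GenFunBounds.abs_prodObs_le_one (D.scheme g₀) h1 K os U)
    (fun K t ht hK => (X.reprA K t ht hK).le) (fun K t ht hK => (X.reprB K t ht hK).le) X.c₀ X.n₁ X.c₀_pos X.floor
    X.floor' X.sites X.sites' X.Nup_nonneg X.nup_bd X.mup_bd X.R X.isRj X.one_le_R X.ped X.cellP X.liveC X.Zd X.realised
    X.step_le X.disjointJoins X.boxedBirths
    -- the `κ := costT` conversion (the owner's `toWT`, `…ApexT3bWTV` :291–292), INLINE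
    (fun K _ => costT Prod.fst C K (X.R K)) (fun K _ => costT Prod.fst C K (X.R K))
    (fun _ _ _ _ _ _ => le_rfl) (fun _ _ _ _ _ _ => le_rfl)
    X.FcM X.RfM X.FcM' X.RfM'
    -- the re-slacking conversion of the price sentences (leaf-02's `toWTV`, `…ApexT3bWTVS` :367–376), INLINE
    (fun K t ht hK τ hτ => (X.priceM K t ht hK τ hτ).trans
      (Finset.prod_le_prod (fun _ _ => mul_nonneg (mul_nonneg (pshapeTH_nonneg Prod.fst zero_le_one zero_le_one _ _ _ _ _)
        (Real.exp_pos _).le) (Real.exp_pos _).le) fun q hq => mul_le_mul_of_nonneg_right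
          (pshapeTH_mul_exp_birthWT_le_reslack Prod.fst zero_le_one zero_le_one _ _ _ _ (X.huV K hK τ hτ q hq))
          (Real.exp_pos _).le))
    (fun K t ht hK τ hτ => (X.priceM' K t ht hK τ hτ).trans
      (Finset.prod_le_prod (fun _ _ => mul_nonneg (mul_nonneg (pshapeTH_nonneg Prod.fst zero_le_one zero_le_one _ _ _ _ _)
        (Real.exp_pos _).le) (Real.exp_pos _).le) fun q hq => mul_le_mul_of_nonneg_right
          (pshapeTH_mul_exp_birthWT_le_reslack Prod.fst zero_le_one zero_le_one _ _ _ _ (X.huV K hK τ hτ q hq))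
          (Real.exp_pos _).le))
    X.upM X.deadM_nonneg X.resumM X.FM_nonneg X.upM' X.deadM'_nonneg X.resumM' X.FM'_nonneg X.shell X.budget X.sum_r
    X.sum_u X.sum_s X.sum_s₂
  exact ⟨X.l₀, X.vol, K₁ + K₂, X.l₀_pos, X.vol_pos, stringHybridNE7_of_hybridNE7T3bWTVSL D X hK₁ hH⟩

/-- **COROLLARY: EXISTENCE** of the continuum limit of every joint expectation of unit-scale averaged loop variables
(`D.ym4_torus_continuum_limit_exists`), GIVEN the prefixed guarded witnesses — by
`T4ApexHybrid.limit_exists_of_hybridNE7Under`.  CONDITIONAL; NE7b NOT proved. [folklore] -/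
theorem limit_exists_of_countRoadT3bPWTVSL_fsc (D : FiniteEpsData F G) (hM : D.AvgMeasurable)
    (hsign : B16.SignConventions D.C)
    {C : T4PrintedShapeBanking.Consts} {O : PrintedO1s}
    {rr : ℕ} {β₀ : ℝ} (h : ThresholdOK C F.L rr β₀) (hμ : 0 < C.μ) (d n : ℕ)
    (hκ₁ : (d : ℝ) * Real.log F.L + 2 * Real.log 2 ≤ C.κ₁) (hE₀ : Real.log (2 + birthMass C) ≤ C.E₀)
    (hA₀ : 1 ≤ C.A₀) (hβ₀ : 0 < β₀) (hLβ : (F.L : ℝ) * β₀ ≤ 1) (hn₁ : 13 ≤ C.n₁) (hn : 0 < n)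
    {θ θv : ℝ} (hθ : 0 < θ) (hslack : C.a + (θ + θv) ≤ O.γ₀ * O.A₁ ^ 2 / 2)
    (hE₂ : 0 < C.E₂) (hE₃ : 0 ≤ C.E₃) {sS : ℕ} (hsS : 1 ≤ sS)
    (hsmall : (((2 * cth 32 1 sS + 1) ^ d : ℕ) : ℝ) * (5 : ℝ) ^ d * ((max 1 (2 * 32 + 2) : ℕ) : ℝ) ≤
      (F.L : ℝ) ^ (sS / 2) / 2)
    {θc : ℝ} (hθc0 : 0 ≤ θc) (hθc1 : θc < 1) (hθcs : 1 / 2 ≤ θc ^ sS)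
    (hData : T4ContinuumYM4Torus.ForSmallCouplings D fun g₀ => ∀ os : List (ULoop F),
        ∃ (ι α π : Type) (_ : DecidableEq ι) (_ : DecidableEq α) (_ : DecidableEq π),
          Nonempty (CountRoadWitnessT3bWTVSL D C O θv rr d n hn g₀ os ι α π)) :
    D.ym4_torus_continuum_limit_exists :=
  T4ApexHybrid.limit_exists_of_hybridNE7Under D hM
    (hybridNE7Under_of_countRoadT3bPWTVSL_fsc D hM hsign h hμ d n hκ₁ hE₀ hA₀ hβ₀ hLβ hn₁ hn hθ hslack hE₂ hE₃ hsS hsmall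
      hθc0 hθc1 hθcs hData)

/-- **COROLLARY: UNIQUENESS** of the limit points (`D.ym4_torus_continuum_limit_unique`) under the same displayed data — by
`T4ApexHybrid.limit_unique_of_hybridNE7Under`.  CONDITIONAL; NE7b NOT proved. [folklore] -/
theorem limit_unique_of_countRoadT3bPWTVSL_fsc (D : FiniteEpsData F G) (hM : D.AvgMeasurable)
    (hsign : B16.SignConventions D.C)
    {C : T4PrintedShapeBanking.Consts} {O : PrintedO1s}
    {rr : ℕ} {β₀ : ℝ} (h : ThresholdOK C F.L rr β₀) (hμ : 0 < C.μ) (d n : ℕ)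
    (hκ₁ : (d : ℝ) * Real.log F.L + 2 * Real.log 2 ≤ C.κ₁) (hE₀ : Real.log (2 + birthMass C) ≤ C.E₀)
    (hA₀ : 1 ≤ C.A₀) (hβ₀ : 0 < β₀) (hLβ : (F.L : ℝ) * β₀ ≤ 1) (hn₁ : 13 ≤ C.n₁) (hn : 0 < n)
    {θ θv : ℝ} (hθ : 0 < θ) (hslack : C.a + (θ + θv) ≤ O.γ₀ * O.A₁ ^ 2 / 2)
    (hE₂ : 0 < C.E₂) (hE₃ : 0 ≤ C.E₃) {sS : ℕ} (hsS : 1 ≤ sS)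
    (hsmall : (((2 * cth 32 1 sS + 1) ^ d : ℕ) : ℝ) * (5 : ℝ) ^ d * ((max 1 (2 * 32 + 2) : ℕ) : ℝ) ≤
      (F.L : ℝ) ^ (sS / 2) / 2)
    {θc : ℝ} (hθc0 : 0 ≤ θc) (hθc1 : θc < 1) (hθcs : 1 / 2 ≤ θc ^ sS)
    (hData : T4ContinuumYM4Torus.ForSmallCouplings D fun g₀ => ∀ os : List (ULoop F),
        ∃ (ι α π : Type) (_ : DecidableEq ι) (_ : DecidableEq α) (_ : DecidableEq π),
          Nonempty (CountRoadWitnessT3bWTVSL D C O θv rr d n hn g₀ os ι α π)) :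
    D.ym4_torus_continuum_limit_unique :=
  T4ApexHybrid.limit_unique_of_hybridNE7Under D hM
    (hybridNE7Under_of_countRoadT3bPWTVSL_fsc D hM hsign h hμ d n hκ₁ hE₀ hA₀ hβ₀ hLβ hn₁ hn hθ hslack hE₂ hE₃ hsS hsmall
      hθc0 hθc1 hθcs hData)

end Under

section SU

variable {F : T4Family} {N : ℕ} [NeZero N] {ℰ : LoopAverage (Matrix.specialUnitaryGroup (Fin N) ℂ)}

/-! ## §2 The four targets and the headline over the guarded repaired END v3.1 from the guarded weighted witness -/

/-- **THE FOUR T⁴ TARGETS FROM THE COUNT ROAD OVER THE GUARDED REPAIRED END v3.1, GUARDED WEIGHTED `κ := costT` WITNESS,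
SPLIT SLACK**, for (0.4)-block-averaged data on `SU(N)` with a measurable small-loop average — §1 ∘
`T4ApexHybrid.targets_of_hybridNE7Under`.  CONDITIONAL on (B), `BetaPertHyp` (inside the targets' own prefix) and the
displayed prefixed witnesses; NE7b NOT proved. [folklore] -/
theorem targets_of_countRoadT3bPWTVSL_fsc (D : FiniteEpsData F (Matrix.specialUnitaryGroup (Fin N) ℂ))
    (hBA : D.IsBlockAveraged ℰ) (hE : ℰ.MeasurableE) (hsign : B16.SignConventions D.C)
    {C : T4PrintedShapeBanking.Consts} {O : PrintedO1s}
    {rr : ℕ} {β₀ : ℝ} (h : ThresholdOK C F.L rr β₀) (hμ : 0 < C.μ) (d n : ℕ)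
    (hκ₁ : (d : ℝ) * Real.log F.L + 2 * Real.log 2 ≤ C.κ₁) (hE₀ : Real.log (2 + birthMass C) ≤ C.E₀)
    (hA₀ : 1 ≤ C.A₀) (hβ₀ : 0 < β₀) (hLβ : (F.L : ℝ) * β₀ ≤ 1) (hn₁ : 13 ≤ C.n₁) (hn : 0 < n)
    {θ θv : ℝ} (hθ : 0 < θ) (hslack : C.a + (θ + θv) ≤ O.γ₀ * O.A₁ ^ 2 / 2)
    (hE₂ : 0 < C.E₂) (hE₃ : 0 ≤ C.E₃) {sS : ℕ} (hsS : 1 ≤ sS)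
    (hsmall : (((2 * cth 32 1 sS + 1) ^ d : ℕ) : ℝ) * (5 : ℝ) ^ d * ((max 1 (2 * 32 + 2) : ℕ) : ℝ) ≤
      (F.L : ℝ) ^ (sS / 2) / 2)
    {θc : ℝ} (hθc0 : 0 ≤ θc) (hθc1 : θc < 1) (hθcs : 1 / 2 ≤ θc ^ sS)
    (hData : T4ContinuumYM4Torus.ForSmallCouplings D fun g₀ => ∀ os : List (ULoop F),
        ∃ (ι α π : Type) (_ : DecidableEq ι) (_ : DecidableEq α) (_ : DecidableEq π),
          Nonempty (CountRoadWitnessT3bWTVSL D C O θv rr d n hn g₀ os ι α π)) :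
    D.ym4_torus_continuum_limit_exists ∧ D.ym4_torus_continuum_limit_unique ∧
      D.limit_reflectionPositive ∧ D.limit_torusCovariant :=
  T4ApexHybrid.targets_of_hybridNE7Under hBA hE
    (hybridNE7Under_of_countRoadT3bPWTVSL_fsc D (hBA.avgMeasurable hE) hsign h hμ d n hκ₁ hE₀ hA₀ hβ₀ hLβ hn₁ hn hθ
      hslack hE₂ hE₃ hsS hsmall hθc0 hθc1 hθcs hData)

/-- **THE HEADLINE PREDICATE FROM THE COUNT ROAD OVER THE GUARDED REPAIRED END v3.1, GUARDED WEIGHTED `κ := costT`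
WITNESS, SPLIT SLACK**: `T4ContinuumYM4Torus.ContinuumYM4Torus D` for (0.4)-block-averaged data on `SU(N)` with a
measurable small-loop average, GIVEN the two pins `(B) = B16.EndStatementBPrinted D.C` and `BetaPertHyp D.βfun` BY NAME,
the datum's sign conventions, the repaired END's INHABITED constants-only side conditions with the split slack
`C.a + (θ + θᵥ) ≤ ½γ₀A₁²` (`0 < θ`; `exists_consts_countRoadT3bPWTVS` of B), and a GUARDED weighted witness
`CountRoadWitnessT3bWTVSL D C O θᵥ …` for all small-coupling tuned runs and every loop string — §2's targets ∘
`T4ContinuumYM4Torus.continuumYM4Torus_of_targets`.  The witness's `disjointJoins` field is the guarded display (a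
theorem on pass V); nothing of H3^NE7b is discharged here.  NE7b NOT proved; count 0∕9. [folklore] -/
theorem continuumYM4Torus_of_countRoadT3bPWTVSL_fsc (D : FiniteEpsData F (Matrix.specialUnitaryGroup (Fin N) ℂ))
    (hBA : D.IsBlockAveraged ℰ) (hE : ℰ.MeasurableE)
    (hB : B16.EndStatementBPrinted D.C) (hβ : BetaPertHyp D.βfun) (hsign : B16.SignConventions D.C)
    {C : T4PrintedShapeBanking.Consts} {O : PrintedO1s}
    {rr : ℕ} {β₀ : ℝ} (h : ThresholdOK C F.L rr β₀) (hμ : 0 < C.μ) (d n : ℕ)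
    (hκ₁ : (d : ℝ) * Real.log F.L + 2 * Real.log 2 ≤ C.κ₁) (hE₀ : Real.log (2 + birthMass C) ≤ C.E₀)
    (hA₀ : 1 ≤ C.A₀) (hβ₀ : 0 < β₀) (hLβ : (F.L : ℝ) * β₀ ≤ 1) (hn₁ : 13 ≤ C.n₁) (hn : 0 < n)
    {θ θv : ℝ} (hθ : 0 < θ) (hslack : C.a + (θ + θv) ≤ O.γ₀ * O.A₁ ^ 2 / 2)
    (hE₂ : 0 < C.E₂) (hE₃ : 0 ≤ C.E₃) {sS : ℕ} (hsS : 1 ≤ sS)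
    (hsmall : (((2 * cth 32 1 sS + 1) ^ d : ℕ) : ℝ) * (5 : ℝ) ^ d * ((max 1 (2 * 32 + 2) : ℕ) : ℝ) ≤
      (F.L : ℝ) ^ (sS / 2) / 2)
    {θc : ℝ} (hθc0 : 0 ≤ θc) (hθc1 : θc < 1) (hθcs : 1 / 2 ≤ θc ^ sS)
    (hData : T4ContinuumYM4Torus.ForSmallCouplings D fun g₀ => ∀ os : List (ULoop F),
        ∃ (ι α π : Type) (_ : DecidableEq ι) (_ : DecidableEq α) (_ : DecidableEq π),
          Nonempty (CountRoadWitnessT3bWTVSL D C O θv rr d n hn g₀ os ι α π)) :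
    T4ContinuumYM4Torus.ContinuumYM4Torus D :=
  T4ContinuumYM4Torus.continuumYM4Torus_of_targets hB hβ
    (targets_of_countRoadT3bPWTVSL_fsc D hBA hE hsign h hμ d n hκ₁ hE₀ hA₀ hβ₀ hLβ hn₁ hn hθ hslack hE₂ hE₃ hsS hsmall
      hθc0 hθc1 hθcs hData)

/-! ## §3 The guarded headline is at least as strong as B's (round trip, by name) -/

/- **FROM B's OWN HYPOTHESES (p281090 `continuumYM4Torus_of_countRoadT3bPWTVS_fsc`; binder TYPES verbatim), ITS CONCLUSION
THROUGH THE GUARDED HEADLINE (kernel-checked `example`).**  Every landed VS-witness is a guarded witness by the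
owner's `CountRoadWitnessT3bWTVS.toL` (`disjointJoinsL_of_disjointJoins` on the one field), so B's prefixed hypothesis
maps into §2's by `ForSmallCouplings.mono`: L ⊒ B BY NAME.  An `example`, not a named theorem, because its statement IS
B's.  Nothing of print asserted; NE7b NOT proved. [folklore] -/
example (D : FiniteEpsData F (Matrix.specialUnitaryGroup (Fin N) ℂ))
    (hBA : D.IsBlockAveraged ℰ) (hE : ℰ.MeasurableE)
    (hB : B16.EndStatementBPrinted D.C) (hβ : BetaPertHyp D.βfun) (hsign : B16.SignConventions D.C)
    {C : T4PrintedShapeBanking.Consts} {O : PrintedO1s}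
    {rr : ℕ} {β₀ : ℝ} (h : ThresholdOK C F.L rr β₀) (hμ : 0 < C.μ) (d n : ℕ)
    (hκ₁ : (d : ℝ) * Real.log F.L + 2 * Real.log 2 ≤ C.κ₁) (hE₀ : Real.log (2 + birthMass C) ≤ C.E₀)
    (hA₀ : 1 ≤ C.A₀) (hβ₀ : 0 < β₀) (hLβ : (F.L : ℝ) * β₀ ≤ 1) (hn₁ : 13 ≤ C.n₁) (hn : 0 < n)
    {θ θv : ℝ} (hθ : 0 < θ) (hslack : C.a + (θ + θv) ≤ O.γ₀ * O.A₁ ^ 2 / 2)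
    (hE₂ : 0 < C.E₂) (hE₃ : 0 ≤ C.E₃) {sS : ℕ} (hsS : 1 ≤ sS)
    (hsmall : (((2 * cth 32 1 sS + 1) ^ d : ℕ) : ℝ) * (5 : ℝ) ^ d * ((max 1 (2 * 32 + 2) : ℕ) : ℝ) ≤
      (F.L : ℝ) ^ (sS / 2) / 2)
    {θc : ℝ} (hθc0 : 0 ≤ θc) (hθc1 : θc < 1) (hθcs : 1 / 2 ≤ θc ^ sS)
    (hData : T4ContinuumYM4Torus.ForSmallCouplings D fun g₀ => ∀ os : List (ULoop F),
        ∃ (ι α π : Type) (_ : DecidableEq ι) (_ : DecidableEq α) (_ : DecidableEq π),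
          Nonempty (CountRoadWitnessT3bWTVS D C O θv rr d n hn g₀ os ι α π)) :
    T4ContinuumYM4Torus.ContinuumYM4Torus D :=
  continuumYM4Torus_of_countRoadT3bPWTVSL_fsc D hBA hE hB hβ hsign h hμ d n hκ₁ hE₀ hA₀ hβ₀ hLβ hn₁ hn hθ hslack hE₂ hE₃
    hsS hsmall hθc0 hθc1 hθcs
    (hData.mono fun g₀ hg os => by
      obtain ⟨ι, α, π, i₁, i₂, i₃, ⟨X⟩⟩ := hg os
      exact ⟨ι, α, π, i₁, i₂, i₃, ⟨X.toL⟩⟩)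

end SU

end

end Summit.QuantumFields.BalabanUV.T4Continuum.HistoryRealiseCellsRunHeadlineT3bPWTVSL
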